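import Summits.QuantumFields.BalabanUV.T4Continuum.Support.DirichletSplitPieces

/-!
# `BalabanUV.T4Continuum.Support.DirichletSplittableCriterion` — NE2 (node U1a) formalisation swarm, SUPPLIER item «Δ1-LOCAL» under the
# owner's sub-row `T4-U1a.S-NE2-D1-DIRICHLET°`: THE EXACT COMBINATORIAL CONTENT OF `SplittableAt` — a vertex patch is splittable along `μ`
# IFF no patch-internal face-path of `S`-blocks joins a TOP-EXPOSED LOWER block to a BOTTOM-EXPOSED UPPER block («no μ-conflict path»)
# (unit b2b-balaban-t4-ne2-formalise-leaf-08, gen 5, file 6 — the located residue made precise in the kernel)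

HONEST FRAMING.  Rung (B)+1 bookkeeping at MODEL level (U = 1 scalar layer), finite torus; pure combinatorics; NE2 (U1a) is NOT proved by this
file; spine PROVED 0/9 unchanged; NOT infinite volume, NOT the mass gap, NOT Clay.  HONEST DEPENDENCY (verbatim): «continuum YM on T⁴ ⇐
BetaPertH ∧ nine spine estimates (0/9 proved); BetaPertH ⇐ (D1) ∧ (D4) ∧ CAP+tail; G-an2-4 gates asym, D1 and NE2/3/4.»

WHAT THIS FILE PROVES (0 sorry; file 1 `DirichletSplitPieces` BY NAME).  At a vertex `v` and axis `μ` call a patch block `b ∈ S` TOP-EXPOSED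
LOWER if it is lower along `μ` and `b + e_μ ∉ S`, BOTTOM-EXPOSED UPPER if it is upper and `b − e_μ ∉ S`; let `PConn` be reachability through
face-adjacent `S`-blocks OF THE PATCH (`Relation.ReflTransGen` of `padj`).
 * **`splittableAt_of_conflictFree`**: if no top-exposed lower block is `PConn`-joined to a bottom-exposed upper block, the patch is
   splittable (colour `σ b :=` «`b` is not joined to any bottom-exposed upper block»);
 * **`conflictFree_of_splittableAt`**: conversely a splitting colour is constant along `PConn` and is forced to `σ` on top-exposed lower
   blocks, to `¬σ` on bottom-exposed upper blocks;
 * **`splittableAt_iff_conflictFree`**, **`locallySplittable_iff_conflictFree`**.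
 So the hypothesis of the «Δ1-LOCAL» ENDs (file 4) is EXACTLY «no μ-conflict path in any vertex patch, for every μ», and the LOCATED RESIDUE of
 the scalar Dirichlet layer after this item is EXACTLY the block sets having a vertex patch with a μ-conflict path — minimal instance: the
 spiral 4-chain `t⁻ → s⁻ → s⁺ … → t′⁺` of cubes around a vertex (d ≥ 3); in d = 2 there is none (file 5 `locallySplittable₂`).

ABSOLUTE RULE (cell, verbatim): «No internally-minted statement may enter as a cited fact. Every hypothesis is either kernel-proved in
this package or a verbatim quotation of a PUBLISHED theorem with page reference. The manuscript(s) under audit are NOT citable for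
their own disputed steps — they are the thing under adjudication; programme-internal (2001/route/tribunal) claims are never citable.»
[folklore]; parametrised shape predicates only; no `def … : Prop` fact.  NOT CLAIMED: anything analytic; NE2; NE3; «not in print».
-/

namespace Summit.QuantumFields.BalabanUV.T4Continuum.DirichletSplittableCriterion

open Literature.MathematicalPhysics.QuantumFieldTheory.Balaban1983to89.B5Prop11Plancherel (Tor unitVec)
open Summit.QuantumFields.BalabanUV.T4Continuum.DirichletMonotoneCutoff (InPatch DownClosed UpClosed)
open Summit.QuantumFields.BalabanUV.T4Continuum.DirichletSplitPieces (AdjConst SplittableAt LocallySplittable AdjConst.iff_of_adj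
  inPatch_sub_of_upper inPatch_add_of_lower)

variable {d : ℕ} (M : Fin d → ℕ) (S : Tor M → Prop) (v : Tor M) (μ : Fin d)

/-! ## §1 Patch-internal face paths and the exposed blocks -/

/-- [shape] face adjacency between two `S`-blocks OF THE PATCH of `v`. [folklore] -/
def padj (b b' : Tor M) : Prop :=
  InPatch M v b ∧ InPatch M v b' ∧ S b ∧ S b' ∧ ∃ ν : Fin d, b' = b + unitVec M ν ∨ b = b' + unitVec M ν

/-- [shape] reachability through patch-internal face paths of `S`-blocks. [folklore] -/
def PConn (b b' : Tor M) : Prop := Relation.ReflTransGen (padj M S v) b b'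

/-- [shape] a TOP-EXPOSED LOWER block of the patch along `μ`. [folklore] -/
def TopExposedLower (b : Tor M) : Prop := InPatch M v b ∧ v μ = b μ + 1 ∧ S b ∧ ¬ S (b + unitVec M μ)

/-- [shape] a BOTTOM-EXPOSED UPPER block of the patch along `μ`. [folklore] -/
def BotExposedUpper (b : Tor M) : Prop := InPatch M v b ∧ v μ = b μ ∧ S b ∧ ¬ S (b - unitVec M μ)

/-- [shape] **NO μ-CONFLICT PATH**: no top-exposed lower block is joined to a bottom-exposed upper block through face-adjacent `S`-blocks of
the patch. [folklore] -/
def ConflictFree : Prop := ∀ b₁ b₂, TopExposedLower M S v μ b₁ → BotExposedUpper M S v μ b₂ → ¬ PConn M S v b₁ b₂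

variable {M S v μ}

/-- `padj` is symmetric. [folklore] -/
theorem padj_symm {b b' : Tor M} (h : padj M S v b b') : padj M S v b' b := by
  obtain ⟨hP, hP', hS, hS', ν, hν⟩ := h
  exact ⟨hP', hP, hS', hS, ν, hν.symm⟩

/-- `PConn` is symmetric. [folklore] -/
theorem PConn.symm {b b' : Tor M} (h : PConn M S v b b') : PConn M S v b' b := by
  unfold PConn at *
  induction h with
  | refl => exact Relation.ReflTransGen.refl
  | tail _ hbc ih => exact Relation.ReflTransGen.head (padj_symm hbc) ih

/-- an upper `S`-block whose lower neighbour is in `S` is `padj` to it. [folklore] -/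
theorem padj_sub {b : Tor M} (hP : InPatch M v b) (hu : v μ = b μ) (hS : S b) (hS' : S (b - unitVec M μ)) :
    padj M S v b (b - unitVec M μ) :=
  ⟨hP, inPatch_sub_of_upper M hP hu, hS, hS', μ, Or.inr (sub_add_cancel b _).symm⟩

/-- a lower `S`-block whose upper neighbour is in `S` is `padj` to it. [folklore] -/
theorem padj_add {b : Tor M} (hP : InPatch M v b) (hl : v μ = b μ + 1) (hS : S b) (hS' : S (b + unitVec M μ)) :
    padj M S v b (b + unitVec M μ) :=
  ⟨hP, inPatch_add_of_lower M hP hl, hS, hS', μ, Or.inl rfl⟩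

/-! ## §2 The characterisation -/

/-- **NO CONFLICT PATH ⟹ SPLITTABLE**: colour a block by «not joined to any bottom-exposed upper block». [folklore] -/
theorem splittableAt_of_conflictFree (h : ConflictFree M S v μ) : SplittableAt M S v μ := by
  refine ⟨fun b => ¬ ∃ b₂, BotExposedUpper M S v μ b₂ ∧ PConn M S v b b₂, ?_, ?_, ?_⟩
  · -- constancy across internal faces
    intro b ν hP hP' hS hS'
    have ha : padj M S v b (b + unitVec M ν) := ⟨hP, hP', hS, hS', ν, Or.inl rfl⟩
    constructor
    · rintro hb ⟨b₂, hb₂, hc⟩; exact hb ⟨b₂, hb₂, Relation.ReflTransGen.head ha hc⟩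
    · rintro hb ⟨b₂, hb₂, hc⟩; exact hb ⟨b₂, hb₂, Relation.ReflTransGen.head (padj_symm ha) hc⟩
  · -- the coloured class is downward-closed
    rintro b hP hu ⟨hS, hσ⟩
    have hS' : S (b - unitVec M μ) := by
      by_contra hn
      exact hσ ⟨b, ⟨hP, hu, hS, hn⟩, Relation.ReflTransGen.refl⟩
    refine ⟨hS', fun ⟨b₂, hb₂, hc⟩ => hσ ⟨b₂, hb₂, Relation.ReflTransGen.head (padj_sub hP hu hS hS') hc⟩⟩
  · -- the uncoloured class is upward-closed
    rintro b hP hl ⟨hS, hσ⟩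
    obtain ⟨b₂, hb₂, hc⟩ := not_not.mp hσ
    have hS' : S (b + unitVec M μ) := by
      by_contra hn
      exact h b b₂ ⟨hP, hl, hS, hn⟩ hb₂ hc
    refine ⟨hS', fun hn => hn ⟨b₂, hb₂, Relation.ReflTransGen.head (padj_symm (padj_add hP hl hS hS')) hc⟩⟩

/-- a splitting colour is constant along `padj`. [folklore] -/
theorem iff_of_padj {σ : Tor M → Prop} (hA : AdjConst M S σ v) {b b' : Tor M} (h : padj M S v b b') : (σ b ↔ σ b') := by
  obtain ⟨hP, hP', hS, hS', ν, hν⟩ := h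
  exact hA.iff_of_adj M hP hP' hS hS' hν

/-- … hence along `PConn`. [folklore] -/
theorem iff_of_PConn {σ : Tor M → Prop} (hA : AdjConst M S σ v) {b b' : Tor M} (h : PConn M S v b b') : (σ b ↔ σ b') := by
  unfold PConn at h
  induction h with
  | refl => exact Iff.rfl
  | tail _ hbc ih => exact ih.trans (iff_of_padj hA hbc)

/-- **SPLITTABLE ⟹ NO CONFLICT PATH**: a top-exposed lower block must carry the down colour, a bottom-exposed upper block the up colour,
and the colour is constant along patch-internal face paths. [folklore] -/
theorem conflictFree_of_splittableAt (h : SplittableAt M S v μ) : ConflictFree M S v μ := by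
  obtain ⟨σ, hA, hD, hU⟩ := h
  intro b₁ b₂ h₁ h₂ hc
  obtain ⟨hP₁, hl₁, hS₁, hn₁⟩ := h₁
  obtain ⟨hP₂, hu₂, hS₂, hn₂⟩ := h₂
  have hσ₁ : σ b₁ := by
    by_contra hσ
    exact hn₁ (hU b₁ hP₁ hl₁ ⟨hS₁, hσ⟩).1
  have hσ₂ : ¬ σ b₂ := fun hσ => hn₂ (hD b₂ hP₂ hu₂ ⟨hS₂, hσ⟩).1
  exact hσ₂ ((iff_of_PConn hA hc).mp hσ₁)

/-- **THE CHARACTERISATION**: `SplittableAt M S v μ ↔ ConflictFree M S v μ`. [folklore] -/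
theorem splittableAt_iff_conflictFree : SplittableAt M S v μ ↔ ConflictFree M S v μ :=
  ⟨conflictFree_of_splittableAt, splittableAt_of_conflictFree⟩

variable (M S) in
/-- **`LocallySplittable M S ↔` no μ-conflict path in any vertex patch, for every axis** — the exact hypothesis of the «Δ1-LOCAL» ENDs
(`DirichletSplittableTwoLevel.injected_le_of_locallySplittable`, `towerLimitRate_dirichletScalar_splittable`). [folklore] -/
theorem locallySplittable_iff_conflictFree : LocallySplittable M S ↔ ∀ v μ, ConflictFree M S v μ :=
  ⟨fun h v μ => conflictFree_of_splittableAt (h v μ), fun h v μ => splittableAt_of_conflictFree (h v μ)⟩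

end Summit.QuantumFields.BalabanUV.T4Continuum.DirichletSplittableCriterion
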